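import Literature.Probability.LatticeModels.PoissonDelaunayIsing
import Literature.Probability.LatticeModels.PoissonDelaunayIsingScaling
import Literature.Probability.LatticeModels.PoissonDelaunayIsingQuenchedMeasurable
import Literature.Analysis.FunctionSpaces.PointConfigFactorialMeasure
import Literature.Analysis.FunctionSpaces.PoissonDistinctValues
import Literature.Analysis.FunctionSpaces.PoissonPointProcessExistence
import HarnessLib

/-!
# Crux `ConformalPoissonDevice.DeviceWeylUniversality` (stmt-CriticalPhenomena-4722), line `birth` —
# stub F2 `stub_flatMeasurable`

Route `ConformalPoissonDevice`, sub-problem `Ising3DConformalLimit`; stub F2 of the lead's skeleton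
of the line `birth` (`Cruxes/DeviceWeylUniversality/Lines/birth.lean`): **the quenched FLAT
integrand `ω ↦ quenchedCorr ω β n x` (plus state of the nearest-neighbour Ising model on the
Delaunay graph of `ω`, read at the Euclidean-nearest vertices of the marked points) is
a.e.-strongly measurable for the count σ-algebra under the homogeneous Poisson law
`poissonLaw (N • vol)` on `ℝ³`**, so that `pdCorr (N • vol) β n x` is a genuine expectation.

This is the specialisation to `E = ℝ³`, intensity `N • vol`, of the tree's
`Literature.Probability.LatticeModels.aestronglyMeasurable_quenchedCorr`
(`Literature/Probability/LatticeModels/PoissonDelaunayIsingQuenchedMeasurable.lean`, with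
`PoissonDelaunayIsingTemplate.lean` and `PoissonDelaunayIsingMeasurable.lean`): the quenched
correlator is a.e. equal to a measurable function of the counts under every law charging no
distance ties, and ties are null for Poisson laws with a Haar-multiple intensity
(`ae_injOn_dist_of_isPoissonPointProcess`, `isPoissonPointProcess_poissonLaw_smul_addHaar` of
`PoissonDelaunayIsingScaling.lean`).

Sources: G. Last, M. Penrose, *Lectures on the Poisson Process*, CUP 2017 (Campbell/Mecke
measurability, Prop. 4.3, Thm 4.1); S. Friedli, Y. Velenik, *Statistical mechanics of lattice
systems*, CUP 2017, §3.1 (finite-volume Gibbs measures depend only on the local graph).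
-/

noncomputable section

open MeasureTheory
open Literature.Analysis.FunctionSpaces Literature.Probability.LatticeModels
open scoped ENNReal NNReal

namespace Summit.CriticalPhenomena.Ising3DConformalLimit.Theorems.DeviceWeylUniversality

/-- Under the homogeneous Poisson law of intensity `N • vol` on `ℝ³`, for a fixed point `y` almost
surely no two sites are equidistant from `y` (distance spheres are Lebesgue-null; Mecke).
[cite: LastPenrose2017, Thm 4.1] -/
theorem flatMeasurable_ae_injOn_dist (N : ℕ) (y : EuclideanSpace ℝ (Fin 3)) :
    ∀ᵐ ω ∂(poissonLaw ((N : ENNReal) • (volume : Measure (EuclideanSpace ℝ (Fin 3))))),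
      Set.InjOn (fun p => dist y p) ((ω : PointConfig (EuclideanSpace ℝ (Fin 3))) : Set _) := by
  have hP := isPoissonPointProcess_poissonLaw_smul_addHaar
    (volume : Measure (EuclideanSpace ℝ (Fin 3))) (N : ℝ≥0)
  exact ae_injOn_dist_of_isPoissonPointProcess (volume : Measure (EuclideanSpace ℝ (Fin 3)))
    (N : ℝ≥0) hP y

/-- **Stub F2 (`stub_flatMeasurable`) of the line `birth` of crux `DeviceWeylUniversality`**: for
every `β`, intensity `N` and marked points `x`, the quenched flat integrand
`ω ↦ quenchedCorr ω β n x` is a.e.-strongly measurable under `poissonLaw (N • vol)` on `ℝ³`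
(tree `aestronglyMeasurable_quenchedCorr` + null distance ties). [cite: LastPenrose2017, Thm 4.1] -/
theorem stub_flatMeasurable :
    ∀ (β : ℝ) (N n : ℕ) (x : Fin n → EuclideanSpace ℝ (Fin 3)),
    MeasureTheory.AEStronglyMeasurable
      (fun ω => Literature.Probability.LatticeModels.quenchedCorr ω β n x)
      (Literature.Probability.LatticeModels.poissonLaw
        ((N : ENNReal) • (MeasureTheory.volume : MeasureTheory.Measure (EuclideanSpace ℝ (Fin 3))))) :=
  fun β N n x => aestronglyMeasurable_quenchedCorr (flatMeasurable_ae_injOn_dist N) β n x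

end Summit.CriticalPhenomena.Ising3DConformalLimit.Theorems.DeviceWeylUniversality

end
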